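import Mathlib
import Summits.Ventures.PercRepro2.LocRows
import Summits.Ventures.PercRepro2.SwRow
import Summits.Ventures.PercRepro2.SwOut
import Summits.Ventures.PercRepro2.SwAllRow
import Summits.Ventures.PercRepro2.SwOutAll
import Summits.Ventures.PercRepro2.SwOutReducible
import Summits.Ventures.PercRepro2.SwOutJunctionH1Defs
import Summits.Ventures.PercRepro2.SwOutJunctionH1Key
import Summits.Ventures.PercRepro2.SwOutJunctionH1Sw
import Summits.Ventures.PercRepro2.SwOutEdgeJunctionKey
import Summits.Ventures.PercRepro2.SwOutEdgeJunctionSw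

/-!
# Theorems A and A⁺ together: the (H1) single junction with at most one edge to `h` (blind cell
PercRepro2, night-4 g16, 2026-08-26; proofs/NIGHT4-G16.md §4)

The two single-junction theorems dispatch on whether the junction `u` is adjacent to `h`: with no
h–u edge, Theorem A (`rigidOK_of_junctionH1`, `sw_of_junctionH1`); with exactly one, Theorem A⁺
(`rigidOK_of_junctionH1Adj`, `sw_of_junctionH1Adj`).  The combined statements take the hypothesis
«at most one h–u edge» (`hhu1`), which holds on every simple graph.
-/

namespace Summit.Ventures.PercRepro2

namespace LocRows

open Hull

variable {V : Type*} {E : Type*} [Fintype E] [DecidableEq E]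

open scoped Classical

variable {ends : E → Sym2 V} {U : Set V} {ξ : Config E} {l h o u : V}

/-- **Theorems A and A⁺**: the rigid inequality on every (H1) single-junction class whose junction
has at most one edge to `h`. -/
theorem rigidOK_of_junctionH1' (hl : l ∉ U) (hhu : h ≠ u) (hloop_h : ∀ e, ends e ≠ s(h, h))
    (hloop_u : ∀ e, ends e ≠ s(u, u))
    (hhu1 : ∀ e e', ends e = s(h, u) → ends e' = s(h, u) → e = e')
    (hout : ∀ x ∈ U, x ≠ h → x ≠ o → x ≠ u →
      (∃ e y, ends e = s(x, y) ∧ y ∉ U) ∨ (∀ e, x ∉ ends e))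
    (hH1 : H1 ends U h u) : RigidOK ends l h o U ξ := by
  by_cases hadj : ∃ e, ends e = s(h, u)
  · exact rigidOK_of_junctionH1Adj hl hhu hloop_h hloop_u hadj hhu1 hout hH1
  · exact rigidOK_of_junctionH1 hl hhu hloop_h hloop_u (fun e he => hadj ⟨e, he⟩) hout hH1

/-- A region with one (H1) junction with at most one edge to `h` is a base region of the series
reduction. -/
theorem reducible_of_junctionH1' (hl : l ∉ U) (hloop_h : ∀ e, ends e ≠ s(h, h))
    (hloop_u : ∀ e, ends e ≠ s(u, u)) (hhu : h ≠ u)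
    (hhu1 : ∀ e e', ends e = s(h, u) → ends e' = s(h, u) → e = e')
    (hout : ∀ x ∈ U, x ≠ h → x ≠ o → x ≠ u →
      (∃ e y, ends e = s(x, y) ∧ y ∉ U) ∨ (∀ e, x ∉ ends e))
    (hH1 : H1 ends U h u) : Reducible l h o ends U :=
  Reducible.base ends U fun ξ =>
    rigidOK_of_junctionH1' (ξ := ξ) hl hhu hloop_h hloop_u hhu1 hout hH1

/-- **Row (SW) on every graph with one (H1) junction having at most one edge to `h`**: every
vertex other than `l, h, o, u` is joined to `l`, no loop at `h` or `u`, at most one h–u edge, and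
(H1) in `{l}ᶜ`. -/
theorem sw_of_junctionH1' (hlh : l ≠ h) (hloop_h : ∀ e, ends e ≠ s(h, h))
    (hloop_u : ∀ e, ends e ≠ s(u, u)) (hhu : h ≠ u)
    (hhu1 : ∀ e e', ends e = s(h, u) → ends e' = s(h, u) → e = e')
    (hH1 : H1 ends ({l}ᶜ) h u)
    (hjoin : ∀ x, x ≠ l → x ≠ h → x ≠ o → x ≠ u → ∃ e, ends e = s(x, l)) : Sw ends l h o := by
  by_cases hadj : ∃ e, ends e = s(h, u)
  · exact sw_of_junctionH1Adj hlh hloop_h hloop_u hhu hadj hhu1 hH1 hjoin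
  · exact sw_of_junctionH1 hlh hloop_h hloop_u hhu (fun e he => hadj ⟨e, he⟩) hH1 hjoin

end LocRows

end Summit.Ventures.PercRepro2
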